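import Summits.NavierStokesRegularity.NavierStokesRegularity.Theses.ContinuousAlignment

/-!
# Route ContinuousAlignment — `Assembly` (item stmt-NavierStokesRegularity-18336)

Pure logic: the route statements of `ContinuousAlignment`, in the antecedent order

  `AprioriContinuousAlignment → ContinuousAlignmentCriterion → NoBlowupToClay → NavierStokesRegularity`,

imply Clay (A). This is, hypothesis for hypothesis, the argument recorded in the docstring of the
route's deciding theorem
`Summit.NavierStokesRegularity.NavierStokesRegularity.Theses.ContinuousAlignment.closes`; the proof
below is self-contained (it does not invoke `closes`, which takes `Assembly` as a binder), so that it
depends only on the item definitions.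

Argument. `NoBlowupToClay` reduces `NavierStokesRegularity` to: every classical solution of unforced
Navier–Stokes on `ℝ³ × [0, T)` that is Leray–Hopf on `[0, T]` from a rapidly decaying datum extends
smoothly past `T`. Fix such `ν, T, u, p`. The residual conjunct W1 = `AprioriContinuousAlignment` at
threshold `d := 1` gives the uniform-in-time modulus of continuity of the vorticity direction on
`{‖ω‖ > 1}`; the attacked conjunct W2 = `ContinuousAlignmentCriterion` at the same threshold turns that
modulus into `HasSmoothExtensionPast ν 0 u T`. Nothing here is new mathematics; the open content lives
in the two cruxes.

## References
* P. Constantin, C. Fefferman, *Direction of vorticity and the problem of global regularity for the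
  Navier–Stokes equations*, Indiana Univ. Math. J. 42 (1993). [ConstantinFefferman1993]
* C. L. Fefferman, *Existence and smoothness of the Navier–Stokes equation*, Clay (2000), (A).
  [Fefferman2000]
-/

-- single-conjunct summit: `Summit.<Summit>.<Problem>` repeats the name by the D-0017 layout
set_option linter.dupNamespace false

namespace Summit.NavierStokesRegularity.NavierStokesRegularity.Theorems

open Summit.NavierStokesRegularity.NavierStokesRegularity.Theses.ContinuousAlignment

/-- **`Assembly`** (item stmt-NavierStokesRegularity-18336 of route ContinuousAlignment):
`AprioriContinuousAlignment → ContinuousAlignmentCriterion → NoBlowupToClay → NavierStokesRegularity`.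
Pure logic (the argument of the route's deciding theorem `closes`, proved from the item definitions
alone): for a classical Leray–Hopf solution from a rapidly decaying datum on `[0, T)`, W1 at threshold
`d := 1` supplies the alignment modulus, W2 at `d := 1` the smooth extension past `T`, and
`NoBlowupToClay` turns "no blow-up" into Clay (A). -/
theorem continuousAlignment_assembly_proof :
    Summit.NavierStokesRegularity.NavierStokesRegularity.Theses.ContinuousAlignment.Assembly := by
  unfold Assembly
  intro h₁ h₂ h₃
  refine h₃ ?_
  intro ν T hν hT u p hcl hLH hdec
  exact h₂ ν T hν hT u p hcl hLH hdec 1 one_pos (h₁ ν T hν hT u p hcl hLH hdec 1 one_pos)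

end Summit.NavierStokesRegularity.NavierStokesRegularity.Theorems
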